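import Summits.SmoothPoincare4.SmoothPoincare4.Theorems.ConvexBisectionAcyclicBisectionExistsComplementPieceRegular
import Summits.SmoothPoincare4.SmoothPoincare4.Theorems.ConvexBisectionAcyclicBisectionExistsDualHandleModelBoundary
import HarnessLib

/-!
# The complement piece `W₂`, V: signs of the level function `Φ` on Milnor's gluing
(helper file 5 of the wave-4 brick T3b (iii) "the complement piece `W₂ = {Φ ≤ 0}` of the pushed
prefix sub-handlebody inside Milnor's gluing" for stub `stub_steinRealisation` (NF6), line
`modp-braid-orbits` r11, crux `ConvexBisection.AcyclicBisectionExists`, item stmt-SmoothPoincare4-10508;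
lead c5, worker Y6)

Setting (V5-REPORT §3): `X = B ∪ (handles)` with data `D`, a sub-family `f : ι' → ι` of handles (the
suffix), `M' = X ∪_Ψ W = G.d₂.Glued` Milnor's gluing with `G.CM` adapted to the belt maps of the handles
`f j` (`CollarAdapted`), and the level function `Φ = levelFn D f G a κ δ` of files I–IV.  This file
computes the SIGN of `Φ` everywhere (`H = modelH κ δ`, Z2's model function of the pushed sub-handlebody):

* in the `j`-th handle chart: `0 ≤ Φ (j_M (D.jB (f j) b)) ↔ 0 ≤ H b` and
  `Φ (j_M (D.jB (f j) b)) ≤ 0 ↔ H b ≤ 0 ∨ ‖b‖ = 1` (`levelFn_jM_jB_nonneg_iff`, `levelFn_jM_jB_nonpos_iff`);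
* off the handle charts `D.jB (f j)`: `Φ (j_M y)` is the collar height of `y`, `≥ 0`, `= 0` iff `y ∈ ∂X`;
* on `j_N (W)`: `Φ ≤ 0`, and `< 0` at interior points of `W`.

So `{Φ ≤ 0} = j_N (W) ∪ ⋃ⱼ j_M (D.jB (f j) {H ≤ 0})` — the complement piece is `W` with the cocore
neighbourhoods `N_j = {H ≤ 0} ∩ D⁴` of the suffix handles (Z2: `cocoreNbhd`) — and, for a map `jX₁`
satisfying the clause list of Y5's pushed prefix embedding, `{0 ≤ Φ} = range jX₁` (file VI).
Everything here is proved; no named facts.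

## References
* J. Milnor, *Morse theory* (1963), Thm. 3.1. [Milnor1963]
* A. A. Kosinski, *Differential Manifolds* (1993), VI §6. [Kosinski1993]
-/

noncomputable section

-- the prescribed namespace `Summit.<P>.<Sub>.…` duplicates `SmoothPoincare4` (P = Sub)
set_option linter.dupNamespace false

open scoped Manifold ContDiff Topology

namespace Summit.SmoothPoincare4.SmoothPoincare4.Theorems.AcyclicBisectionExists.ModpBraidOrbits

open Set Function Metric Filter Topology
open Literature.Topology.FourManifolds Literature.Topology.FourManifolds.HandleAttachingMap

/-! ### §1 The model function on the cocore and on the sphere -/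

section Model

/-- **`H < 0` on the cocore disc**: `modelH κ δ x < 0` when `x_λ = 0`. [folklore] -/
theorem modelH_neg_of_lamPart_sq_eq_zero {κ δ : ℝ} (hκ : 0 < κ) (hδ : 0 < δ) {x : EuclideanSpace ℝ (Fin 4)}
    (hP : ‖lamPart x‖ ^ 2 = 0) : modelH κ δ x < 0 := by
  rcases le_or_gt (‖muPart x‖ ^ 2) (δ / 4) with hQ | hQ
  · rw [modelH_of_le hδ hQ, hP, zero_sub, neg_lt_zero]
    exact pFun_pos hκ (div_nonneg (sq_nonneg _) hδ.le)
  · have hH : modelH κ δ x = ((1 - slabCut (‖muPart x‖ ^ 2 / δ)) * (κ ^ 2 / δ) + slabCut (‖muPart x‖ ^ 2 / δ)) *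
        (δ * ‖lamPart x‖ ^ 2 / κ ^ 2 - ‖muPart x‖ ^ 2) :=
      modelHFun_line hκ hδ hQ.le (by rw [hP]; positivity)
    rw [hH, hP, mul_zero, zero_div, zero_sub]
    have h0 : 0 ≤ slabCut (‖muPart x‖ ^ 2 / δ) := Real.smoothTransition.nonneg _
    have h1 : slabCut (‖muPart x‖ ^ 2 / δ) ≤ 1 := Real.smoothTransition.le_one _
    have hm : 0 < (1 - slabCut (‖muPart x‖ ^ 2 / δ)) * (κ ^ 2 / δ) + slabCut (‖muPart x‖ ^ 2 / δ) := by
      rcases h1.lt_or_eq with h1 | h1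
      · have : 0 < κ ^ 2 / δ := by positivity
        nlinarith [mul_pos (sub_pos.2 h1) this]
      · rw [h1]; norm_num
    have hQ0 : 0 < ‖muPart x‖ ^ 2 := by linarith
    nlinarith [mul_pos hm hQ0]

/-- `0 ≤ H` forces `0 < ‖x_λ‖²`. [folklore] -/
theorem lamPart_sq_pos_of_modelH_nonneg {κ δ : ℝ} (hκ : 0 < κ) (hδ : 0 < δ) {x : EuclideanSpace ℝ (Fin 4)}
    (hH : 0 ≤ modelH κ δ x) : 0 < ‖lamPart x‖ ^ 2 :=
  lt_of_le_of_ne (sq_nonneg _) fun h0 => absurd hH (not_le.2 (modelH_neg_of_lamPart_sq_eq_zero hκ hδ h0.symm))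

/-- **On the seam-zone part of the sphere `H ≤ 0`**, with `H = 0` iff `3κ²/4 ≤ ‖x_λ‖²`. [folklore] -/
theorem modelH_nonpos_of_sphere {κ δ : ℝ} (hκ : 0 < κ) (hκ2 : κ ≤ 1 / 2) (hδ : 0 < δ) (hδ2 : δ ≤ 1 / 2)
    {x : EuclideanSpace ℝ (Fin 4)} (hn : ‖x‖ = 1) (hP : ‖lamPart x‖ ^ 2 < 1 / 4) :
    modelH κ δ x ≤ 0 ∧ (modelH κ δ x = 0 ↔ 3 * κ ^ 2 / 4 ≤ ‖lamPart x‖ ^ 2) := by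
  have hQ : δ / 2 ≤ ‖muPart x‖ ^ 2 := by
    have h1 := norm_sq_eq_lamPart_muPart x
    rw [hn] at h1
    linarith
  rcases lt_or_ge (‖lamPart x‖ ^ 2) (3 * κ ^ 2 / 4) with hP' | hP'
  · have hneg := modelH_neg_of_seam hκ hκ2 hδ hδ2 hn hP'
    exact ⟨hneg.le, ⟨fun h0 => absurd h0 hneg.ne, fun h' => absurd h' (not_le.2 hP')⟩⟩
  · have h0 : modelH κ δ x = 0 := by rw [modelH_eq_one_sub_norm_sq hκ hδ hP' hQ, hn]; ring
    exact ⟨h0.le, ⟨fun _ => hP', fun _ => h0⟩⟩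

end Model

/-! ### §2 Chart points, handle points and the bump images -/

section Charts

variable {B : Type} [TopologicalSpace B] [T2Space B] [ChartedSpace (EuclideanHalfSpace 4) B]
  {ι : Type} [Finite ι] {h : ι → HandleAttachingMap 3 2 B}
  {X : Type} [TopologicalSpace X] [ChartedSpace (EuclideanHalfSpace 4) X] [IsManifold (𝓡∂ 4) ∞ X]
  (D : MultiAttachmentData h (𝓡∂ 4) X) {ι' : Type} [Finite ι'] (f : ι' → ι)
  {bX : BoundaryData (𝓡∂ 4) X (𝓡 3)}
  {W : Type} [TopologicalSpace W] [ChartedSpace (EuclideanHalfSpace 4) W]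
  [IsManifold (𝓡∂ 4) ∞ W] {bW : BoundaryData (𝓡∂ 4) W (𝓡 3)} [Nonempty bX.carrier]
  (G : BoundaryGlueData bX bW) {a κ δ : ℝ}

omit [Finite ι'] in
/-- A chart point of the closed ball is a handle point `j_M (D.jB i b)` with `b` of vector `x`. [folklore] -/
theorem exists_coe_eq_of_norm_le_one (ha : 0 < a) {i : ι} (hCM : CollarAdapted D i G a)
    {x : EuclideanSpace ℝ (Fin 4)} (hx : x ∈ chartDom a) (hn : ‖x‖ ≤ 1) :
    ∃ b : ↥(beltPiece 3 2), ((b : closedBall (0 : EuclideanSpace ℝ (Fin 4)) 1) : EuclideanSpace ℝ (Fin 4)) = x ∧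
      gluedHandleChart D i G a x = G.jM (D.jB i b) := by
  have hlam : lamSq 2 x ≠ 1 := by
    rcases hn.lt_or_eq with h1 | h1
    · exact lamSq_ne_one_of_norm_lt_one h1
    · have hxs : x ∈ seamZone a := hx.resolve_left fun h' => by rw [mem_ball_zero_iff] at h'; exact h'.ne h1
      rw [← norm_lamPart_sq]
      nlinarith [hxs.2.1, norm_nonneg (lamPart x)]
  set b : ↥(beltPiece 3 2) := ⟨⟨x, mem_closedBall_zero_iff.2 hn⟩, by rw [mem_beltPiece]; exact hlam⟩ with hb
  have hbx : ((b : closedBall (0 : EuclideanSpace ℝ (Fin 4)) 1) : EuclideanSpace ℝ (Fin 4)) = x := rfl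
  refine ⟨b, hbx, ?_⟩
  have key := gluedHandleChart_coe D i G ha hCM b (by rw [hbx]; exact hx)
  rw [hbx] at key
  exact key

omit [Finite ι'] in
/-- An interior point of `X` and an arbitrary point of `W` have different images in `M'` … [folklore] -/
theorem jM_ne_jN_of_isInteriorPoint_left {y : X} (hy : (𝓡∂ 4).IsInteriorPoint y) (c : W) : G.jM y ≠ G.jN c := by
  intro heq
  obtain ⟨z, rfl, -⟩ := G.jM_eq_jN_iff.1 heq
  exact ((𝓡∂ 4).isInteriorPoint_iff_not_isBoundaryPoint _).1 hy (bX.incl_mem_boundary z)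

omit [Finite ι'] in
/-- **A point of the bump images is a handle point `j_M (D.jB (f j) b)` with `b` of vector in the support
box and norm `≤ 1`, or `j_N` of an interior point of `W` (vector of norm `> 1`).** [folklore] -/
theorem mem_bumpImages_cases (ha : 0 < a) (hCM : ∀ j, CollarAdapted D (f j) G a) (hκ : 0 < κ) (hκ2 : κ ≤ 1 / 2)
    {p : G.d₂.Glued} (hp : p ∈ bumpImages D f G a κ) :
    ∃ (j : ι') (x : EuclideanSpace ℝ (Fin 4)), x ∈ bumpSupp κ a ∧ gluedHandleChart D (f j) G a x = p ∧
      ((‖x‖ ≤ 1 ∧ ∃ b : ↥(beltPiece 3 2), ((b : closedBall (0 : EuclideanSpace ℝ (Fin 4)) 1) : EuclideanSpace ℝ (Fin 4)) = x ∧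
          p = G.jM (D.jB (f j) b)) ∨
        (1 < ‖x‖ ∧ ∃ c : W, (𝓡∂ 4).IsInteriorPoint c ∧ p = G.jN c)) := by
  obtain ⟨j, hj⟩ := mem_iUnion.1 hp
  obtain ⟨x, hx, rfl⟩ := hj
  have hxV := bumpSupp_subset_chartDom hκ hκ2 ha hx
  refine ⟨j, x, hx, rfl, ?_⟩
  rcases le_or_gt ‖x‖ 1 with hn | hn
  · obtain ⟨b, hb, hbe⟩ := exists_coe_eq_of_norm_le_one D G ha (hCM j) hxV hn
    exact Or.inl ⟨hn, b, hb, hbe⟩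
  · have hxs : x ∈ seamZone a := hxV.resolve_left fun h' => by rw [mem_ball_zero_iff] at h'; linarith
    obtain ⟨c, hc, hce⟩ := exists_gluedHandleChart_eq_jN D (f j) G hxs hn
    exact Or.inr ⟨hn, c, hc, hce⟩

omit [Finite ι'] in
/-- **A handle point off the chart domain is off the bump images.** [folklore] -/
theorem jM_jB_not_mem_bumpImages (ha : 0 < a) (hCM : ∀ j, CollarAdapted D (f j) G a) (hκ : 0 < κ) (hκ2 : κ ≤ 1 / 2)
    (i : ι) (b : ↥(beltPiece 3 2))
    (hb : ((b : closedBall (0 : EuclideanSpace ℝ (Fin 4)) 1) : EuclideanSpace ℝ (Fin 4)) ∉ chartDom a) :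
    G.jM (D.jB i b) ∉ bumpImages D f G a κ := by
  intro hm
  obtain ⟨j, x, hx, -, hcases⟩ := mem_bumpImages_cases D f G ha hCM hκ hκ2 hm
  rcases hcases with ⟨-, b', hb', heq⟩ | ⟨-, c, hc, heq⟩
  · have h1 := G.injective_jM heq
    by_cases hij : i = f j
    · subst hij
      have h2 : b = b' := (D.hjB _).1.isEmbedding.injective h1
      subst h2
      exact hb (hb' ▸ bumpSupp_subset_chartDom hκ hκ2 ha (hb'.symm ▸ hx))
    · exact (D.disjointB hij).ne_of_mem (mem_range_self _) (mem_range_self _) h1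
  · by_cases hbn : ‖((b : closedBall (0 : EuclideanSpace ℝ (Fin 4)) 1) : EuclideanSpace ℝ (Fin 4))‖ < 1
    · exact jM_ne_jN_of_isInteriorPoint_left G (isInteriorPoint_jB D i hbn) c heq
    · exact jM_ne_jN_of_isInteriorPoint G _ hc heq

omit [Finite ι'] in
/-- **A point `j_M y` with `y` off all the handle charts `D.jB (f j)` is off the bump images.** [folklore] -/
theorem jM_not_mem_bumpImages (ha : 0 < a) (hCM : ∀ j, CollarAdapted D (f j) G a) (hκ : 0 < κ) (hκ2 : κ ≤ 1 / 2)
    {y : X} (hy : ∀ (j : ι') (b : ↥(beltPiece 3 2)), D.jB (f j) b ≠ y) : G.jM y ∉ bumpImages D f G a κ := by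
  intro hm
  obtain ⟨j, x, -, -, hcases⟩ := mem_bumpImages_cases D f G ha hCM hκ hκ2 hm
  rcases hcases with ⟨-, b', -, heq⟩ | ⟨-, c, hc, heq⟩
  · exact hy j b' (G.injective_jM heq).symm
  · exact jM_ne_jN_of_isInteriorPoint G _ hc heq

omit [Finite ι'] in
/-- **A point `j_N c` in the bump images is a chart point of vector of norm `≥ 1`.** [folklore] -/
theorem exists_of_jN_mem_bumpImages (ha : 0 < a) (hCM : ∀ j, CollarAdapted D (f j) G a) (hκ : 0 < κ) (hκ2 : κ ≤ 1 / 2)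
    {c : W} (hm : G.jN c ∈ bumpImages D f G a κ) :
    ∃ (j : ι') (x : EuclideanSpace ℝ (Fin 4)), x ∈ bumpSupp κ a ∧ gluedHandleChart D (f j) G a x = G.jN c ∧ 1 ≤ ‖x‖ ∧
      ((𝓡∂ 4).IsInteriorPoint c → 1 < ‖x‖) := by
  obtain ⟨j, x, hx, hxe, hcases⟩ := mem_bumpImages_cases D f G ha hCM hκ hκ2 hm
  refine ⟨j, x, hx, hxe, ?_, fun hc => ?_⟩
  · rcases hcases with ⟨hn, b, hb, heq⟩ | ⟨hn, -⟩
    · by_contra hlt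
      have hbn : ‖((b : closedBall (0 : EuclideanSpace ℝ (Fin 4)) 1) : EuclideanSpace ℝ (Fin 4))‖ < 1 := by
        rw [hb]; exact not_le.1 hlt
      exact absurd heq.symm (jM_ne_jN_of_isInteriorPoint_left G (isInteriorPoint_jB D (f j) hbn) c)
    · exact hn.le
  · rcases hcases with ⟨-, b, -, heq⟩ | ⟨hn, -⟩
    · exact absurd heq.symm (jM_ne_jN_of_isInteriorPoint G _ hc)
    · exact hn

end Charts

/-! ### §3 Signs of the level function -/

section Signs

variable {B : Type} [TopologicalSpace B] [T2Space B] [ChartedSpace (EuclideanHalfSpace 4) B]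
  {ι : Type} [Finite ι] {h : ι → HandleAttachingMap 3 2 B}
  {X : Type} [TopologicalSpace X] [ChartedSpace (EuclideanHalfSpace 4) X] [IsManifold (𝓡∂ 4) ∞ X]
  (D : MultiAttachmentData h (𝓡∂ 4) X) {ι' : Type} [Finite ι'] (f : ι' → ι)
  {bX : BoundaryData (𝓡∂ 4) X (𝓡 3)}
  {W : Type} [TopologicalSpace W] [ChartedSpace (EuclideanHalfSpace 4) W]
  [IsManifold (𝓡∂ 4) ∞ W] {bW : BoundaryData (𝓡∂ 4) W (𝓡 3)} [Nonempty bX.carrier]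
  (G : BoundaryGlueData bX bW) {a κ δ : ℝ}

/-- **The local level function on the closed-ball part of the support box**: `0 ≤ levelLoc x ↔ 0 ≤ H x`
and `levelLoc x ≤ 0 ↔ H x ≤ 0` for `‖x‖ ≤ 1` in the chart domain. [cite: Milnor1963, Thm. 3.1] -/
theorem levelLoc_sign_of_norm_le_one (ha : 0 < a) {i : ι} (hCM : CollarAdapted D i G a) (hκ : 0 < κ) (hκ2 : κ ≤ 1 / 2)
    (hδ : 0 < δ) (hδ2 : δ ≤ 1 / 2) {x : EuclideanSpace ℝ (Fin 4)} (hx : x ∈ chartDom a) (hn : ‖x‖ ≤ 1) :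
    (0 ≤ levelLoc D i G a κ δ x ↔ 0 ≤ modelH κ δ x) ∧ (levelLoc D i G a κ δ x ≤ 0 ↔ modelH κ δ x ≤ 0) := by
  have hω := bumpLoc_mem κ a x
  rw [levelLoc_eq]
  rcases hn.lt_or_eq with hn | hn
  · -- open ball: `Φ₀ ∘ Θ > 0`; `H ≤ 0` forces `Ω = 1`
    have hpos := seamLevelFn_chart_pos D i G (a := a) hn
    by_cases hH : 0 < modelH κ δ x
    · have hval : 0 < (1 - bumpLoc κ a x) * seamLevelFn G (gluedHandleChart D i G a x) + bumpLoc κ a x * modelH κ δ x := by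
        rcases hω.2.lt_or_eq with h1 | h1
        · nlinarith [mul_pos (sub_pos.2 h1) hpos, mul_nonneg hω.1 hH.le]
        · rw [h1]; linarith
      exact ⟨⟨fun _ => hH.le, fun _ => hval.le⟩, ⟨fun h' => absurd h' (not_le.2 hval), fun h' => absurd h' (not_le.2 hH)⟩⟩
    · push Not at hH
      have hP : ‖lamPart x‖ ^ 2 ≤ 3 * κ ^ 2 / 4 := by
        by_contra hP; push Not at hP
        exact absurd (modelH_pos_of_lamSq_gt hκ hκ2 hδ hn hP) (not_lt.2 hH)
      have hκ' : 0 < κ ^ 2 := by positivity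
      have hd : 0 < min (1 / 5 : ℝ) a := lt_min (by norm_num) ha
      rw [bumpLoc_eq_one hκ ha (by nlinarith) (by nlinarith [norm_nonneg x])]
      simp only [sub_self, zero_mul, zero_add, one_mul, and_self]
  · -- sphere: `Φ₀ ∘ Θ = 0`, `H ≤ 0`
    have hxs : x ∈ seamZone a := hx.resolve_left fun h' => by rw [mem_ball_zero_iff] at h'; exact h'.ne hn
    have h0 : seamLevelFn G (gluedHandleChart D i G a x) = 0 := by
      rw [seamLevelFn_chart_of_mem_seamZone D i G ha hCM hxs, signedHeightProfile_eq_zero_iff, seamHeight, hn]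
      simp
    have hP : ‖lamPart x‖ ^ 2 < 1 / 4 := by nlinarith [hxs.2.1, norm_nonneg (lamPart x)]
    obtain ⟨hHle, hHiff⟩ := modelH_nonpos_of_sphere hκ hκ2 hδ hδ2 hn hP
    rw [h0, mul_zero, zero_add]
    refine ⟨⟨fun h' => ?_, fun h' => ?_⟩, ⟨fun _ => hHle, fun _ => mul_nonpos_of_nonneg_of_nonpos hω.1 hHle⟩⟩
    · -- `0 ≤ Ω H` with `H ≤ 0`: either `H = 0` or `Ω = 0`, i.e. `‖x_λ‖² ≥ 3κ²/4`
      by_contra hH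
      push Not at hH
      have hP' : ‖lamPart x‖ ^ 2 < 3 * κ ^ 2 / 4 := by
        by_contra hP'; push Not at hP'; exact hH.ne (hHiff.2 hP')
      have hκ' : 0 < κ ^ 2 := by positivity
      rw [bumpLoc_eq_one hκ ha (by nlinarith) (by rw [hn]; linarith [le_min (by norm_num : (0:ℝ) ≤ 1/5) ha.le]), one_mul] at h'
      exact absurd h' (not_le.2 hH)
    · rw [le_antisymm hHle h', mul_zero]

omit [Finite ι'] in
/-- **`Φ` in the `j`-th handle chart, `≥ 0` form**: `0 ≤ Φ (j_M (D.jB (f j) b)) ↔ 0 ≤ H b`. [cite: Milnor1963, Thm. 3.1] -/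
theorem levelFn_jM_jB_nonneg_iff (ha : 0 < a) (hf : Injective f) (hCM : ∀ j, CollarAdapted D (f j) G a) (hκ : 0 < κ)
    (hκ2 : κ ≤ 1 / 2) (hδ : 0 < δ) (hδ2 : δ ≤ 1 / 2) (j : ι') (b : ↥(beltPiece 3 2)) :
    0 ≤ levelFn D f G a κ δ (G.jM (D.jB (f j) b)) ↔
      0 ≤ modelH κ δ ((b : closedBall (0 : EuclideanSpace ℝ (Fin 4)) 1) : EuclideanSpace ℝ (Fin 4)) := by
  set x := ((b : closedBall (0 : EuclideanSpace ℝ (Fin 4)) 1) : EuclideanSpace ℝ (Fin 4)) with hxb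
  have hn : ‖x‖ ≤ 1 := mem_closedBall_zero_iff.1 b.1.2
  by_cases hx : x ∈ chartDom a
  · rw [← gluedHandleChart_coe D (f j) G ha (hCM j) b hx, levelFn_apply_chart D f G ha hf hCM hκ hκ2 j hx]
    exact (levelLoc_sign_of_norm_le_one D G ha (hCM j) hκ hκ2 hδ hδ2 hx hn).1
  · rw [levelFn_eq_seamLevelFn D f G ha hCM hκ (jM_jB_not_mem_bumpImages D f G ha hCM hκ hκ2 _ b hx)]
    refine ⟨fun _ => ?_, fun _ => seamLevelFn_jM_nonneg G _⟩
    -- off the chart domain: `‖x‖ = 1` and `‖x_λ‖ ≥ ½`, so `H ≥ 0`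
    have hn1 : ‖x‖ = 1 := by
      by_contra h1
      exact hx (Or.inl (mem_ball_zero_iff.2 (lt_of_le_of_ne hn h1)))
    have hlam : 1 / 2 ≤ ‖lamPart x‖ := by
      by_contra hl; push Not at hl
      refine hx (Or.inr ⟨fun hμ => ?_, hl, ?_⟩)
      · have h2 := norm_sq_eq_lamPart_muPart x
        rw [hμ, norm_zero, hn1] at h2
        norm_num at h2
        nlinarith [norm_nonneg (lamPart x)]
      · rw [hn1]; simp [ha]
    refine modelH_nonneg_of_lamSq_gt hκ hκ2 hδ hn ?_
    nlinarith [mul_pos hκ hκ]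

omit [Finite ι'] in
/-- **`Φ` in the `j`-th handle chart, `≤ 0` form**: `Φ (j_M (D.jB (f j) b)) ≤ 0 ↔ H b ≤ 0 ∨ ‖b‖ = 1`.
[cite: Milnor1963, Thm. 3.1] -/
theorem levelFn_jM_jB_nonpos_iff (ha : 0 < a) (hf : Injective f) (hCM : ∀ j, CollarAdapted D (f j) G a) (hκ : 0 < κ)
    (hκ2 : κ ≤ 1 / 2) (hδ : 0 < δ) (hδ2 : δ ≤ 1 / 2) (j : ι') (b : ↥(beltPiece 3 2)) :
    levelFn D f G a κ δ (G.jM (D.jB (f j) b)) ≤ 0 ↔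
      modelH κ δ ((b : closedBall (0 : EuclideanSpace ℝ (Fin 4)) 1) : EuclideanSpace ℝ (Fin 4)) ≤ 0 ∨
        ‖((b : closedBall (0 : EuclideanSpace ℝ (Fin 4)) 1) : EuclideanSpace ℝ (Fin 4))‖ = 1 := by
  set x := ((b : closedBall (0 : EuclideanSpace ℝ (Fin 4)) 1) : EuclideanSpace ℝ (Fin 4)) with hxb
  have hn : ‖x‖ ≤ 1 := mem_closedBall_zero_iff.1 b.1.2
  by_cases hx : x ∈ chartDom a
  · rw [← gluedHandleChart_coe D (f j) G ha (hCM j) b hx, levelFn_apply_chart D f G ha hf hCM hκ hκ2 j hx]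
    have key := (levelLoc_sign_of_norm_le_one D G ha (hCM j) hκ hκ2 hδ hδ2 hx hn (κ := κ)).2
    rw [key]
    refine ⟨Or.inl, fun h' => h'.elim id fun hn1 => ?_⟩
    have hxs : x ∈ seamZone a := hx.resolve_left fun h' => by rw [mem_ball_zero_iff] at h'; exact h'.ne hn1
    exact (modelH_nonpos_of_sphere hκ hκ2 hδ hδ2 hn1 (by nlinarith [hxs.2.1, norm_nonneg (lamPart x)])).1
  · rw [levelFn_eq_seamLevelFn D f G ha hCM hκ (jM_jB_not_mem_bumpImages D f G ha hCM hκ hκ2 _ b hx)]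
    have hn1 : ‖x‖ = 1 := by
      by_contra h1
      exact hx (Or.inl (mem_ball_zero_iff.2 (lt_of_le_of_ne hn h1)))
    refine ⟨fun _ => Or.inr hn1, fun _ => ?_⟩
    have hbd : D.jB (f j) b ∈ (𝓡∂ 4).boundary X := by
      rw [mem_boundary_iff_of_isSmoothEmbedding (D.hjB (f j)).1 (D.hjB (f j)).2, mem_boundary_opens_iff,
        boundary_closedBall]
      exact hn1
    rw [← bX.range_incl] at hbd
    obtain ⟨z, hz⟩ := hbd
    exact ((seamLevelFn_jM_eq_zero_iff G _).2 ⟨z, hz⟩).le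

omit [Finite ι'] in
/-- **`Φ ∘ j_M` off the handle charts is the collar height.** [folklore] -/
theorem levelFn_jM_of_forall_ne (ha : 0 < a) (hCM : ∀ j, CollarAdapted D (f j) G a) (hκ : 0 < κ) (hκ2 : κ ≤ 1 / 2)
    {y : X} (hy : ∀ (j : ι') (b : ↥(beltPiece 3 2)), D.jB (f j) b ≠ y) :
    levelFn D f G a κ δ (G.jM y) = G.CM.collarHeightFn y := by
  rw [levelFn_eq_seamLevelFn D f G ha hCM hκ (jM_not_mem_bumpImages D f G ha hCM hκ hκ2 hy), seamLevelFn_jM]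

omit [Finite ι'] in
/-- **`Φ ∘ j_N ≤ 0`.** [cite: Milnor1963, Thm. 3.1] -/
theorem levelFn_jN_nonpos (ha : 0 < a) (hf : Injective f) (hCM : ∀ j, CollarAdapted D (f j) G a) (hκ : 0 < κ)
    (hκ2 : κ ≤ 1 / 2) (hδ : 0 < δ) (hδ2 : δ ≤ 1 / 2) (c : W) : levelFn D f G a κ δ (G.jN c) ≤ 0 := by
  by_cases hm : G.jN c ∈ bumpImages D f G a κ
  · obtain ⟨j, x, hx, hxe, hn, -⟩ := exists_of_jN_mem_bumpImages D f G ha hCM hκ hκ2 hm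
    have hxV := bumpSupp_subset_chartDom hκ hκ2 ha hx
    rw [← hxe, levelFn_apply_chart D f G ha hf hCM hκ hκ2 j hxV]
    rcases hn.eq_or_lt with hn | hn
    · exact (levelLoc_sign_of_norm_le_one D G ha (hCM j) hκ hκ2 hδ hδ2 hxV hn.symm.le).2.2
        (modelH_nonpos_of_sphere hκ hκ2 hδ hδ2 hn.symm (lamPart_lt_of_mem_bumpSupp hκ2 hκ hx).2).1
    · -- outside the closed ball both summands are `≤ 0`
      have hxs : x ∈ seamZone a := hxV.resolve_left fun h' => by rw [mem_ball_zero_iff] at h'; linarith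
      have hω := bumpLoc_mem κ a x
      have hΦ : seamLevelFn G (gluedHandleChart D (f j) G a x) ≤ 0 := by
        rw [seamLevelFn_chart_of_mem_seamZone D (f j) G ha (hCM j) hxs, signedHeightProfile_nonpos_iff]
        refine div_nonpos_of_nonpos_of_nonneg (by nlinarith) ?_
        linarith [(depth_of_mem_seamZone hxs).2]
      have hQ : δ / 2 ≤ ‖muPart x‖ ^ 2 := by
        have h1 := norm_sq_eq_lamPart_muPart x
        have h2 : κ ^ 2 ≤ 1 / 4 := by nlinarith
        nlinarith [hx.1]
      have hH : modelH κ δ x ≤ 0 := (modelH_le_one_sub_norm_sq hκ hκ2 hδ hδ2 hQ).trans (by nlinarith)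
      rw [levelLoc_eq]
      nlinarith [mul_nonneg (sub_nonneg.2 hω.2) (neg_nonneg.2 hΦ), mul_nonneg hω.1 (neg_nonneg.2 hH)]
  · rw [levelFn_eq_seamLevelFn D f G ha hCM hκ hm]
    exact seamLevelFn_jN_nonpos G c

omit [Finite ι'] in
/-- **`Φ ∘ j_N < 0` at interior points of `W`.** [cite: Milnor1963, Thm. 3.1] -/
theorem levelFn_jN_neg (ha : 0 < a) (hf : Injective f) (hCM : ∀ j, CollarAdapted D (f j) G a) (hκ : 0 < κ)
    (hκ2 : κ ≤ 1 / 2) (hδ : 0 < δ) (hδ2 : δ ≤ 1 / 2) {c : W} (hc : (𝓡∂ 4).IsInteriorPoint c) :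
    levelFn D f G a κ δ (G.jN c) < 0 := by
  by_cases hm : G.jN c ∈ bumpImages D f G a κ
  · obtain ⟨j, x, hx, hxe, -, hn⟩ := exists_of_jN_mem_bumpImages D f G ha hCM hκ hκ2 hm
    have hn := hn hc
    have hxV := bumpSupp_subset_chartDom hκ hκ2 ha hx
    rw [← hxe, levelFn_apply_chart D f G ha hf hCM hκ hκ2 j hxV]
    have hxs : x ∈ seamZone a := hxV.resolve_left fun h' => by rw [mem_ball_zero_iff] at h'; linarith
    have hω := bumpLoc_mem κ a x
    have hΦ : seamLevelFn G (gluedHandleChart D (f j) G a x) < 0 := by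
      rw [seamLevelFn_chart_of_mem_seamZone D (f j) G ha (hCM j) hxs]
      refine signedHeightProfile_neg (div_neg_of_neg_of_pos (by nlinarith) ?_)
      linarith [(depth_of_mem_seamZone hxs).2]
    have hQ : δ / 2 ≤ ‖muPart x‖ ^ 2 := by
      have h1 := norm_sq_eq_lamPart_muPart x
      have h2 : κ ^ 2 ≤ 1 / 4 := by nlinarith
      nlinarith [hx.1]
    have hH : modelH κ δ x < 0 := (modelH_le_one_sub_norm_sq hκ hκ2 hδ hδ2 hQ).trans_lt (by nlinarith)
    rw [levelLoc_eq]
    have hA := mul_le_mul_of_nonneg_left (le_max_left (seamLevelFn G (gluedHandleChart D (f j) G a x)) (modelH κ δ x))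
      (sub_nonneg.2 hω.2)
    have hB := mul_le_mul_of_nonneg_left (le_max_right (seamLevelFn G (gluedHandleChart D (f j) G a x)) (modelH κ δ x)) hω.1
    have hM : max (seamLevelFn G (gluedHandleChart D (f j) G a x)) (modelH κ δ x) < 0 := max_lt hΦ hH
    nlinarith
  · rw [levelFn_eq_seamLevelFn D f G ha hCM hκ hm]
    exact seamLevelFn_jN_neg G hc

/-- **Registered helper `helper_levelFn_signs` (sub-goal of `stub_steinRealisation`, T3b (iii), wave 4,
lead c5): the signs of the level function of the complement piece** — in the handle charts
`0 ≤ Φ ↔ 0 ≤ H` and `Φ ≤ 0 ↔ H ≤ 0 ∨ ‖b‖ = 1`, off them `Φ ∘ j_M` is the collar height, and `Φ ∘ j_N ≤ 0`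
(`< 0` inside). [cite: Milnor1963, Thm. 3.1] -/
theorem helper_levelFn_signs : ∀ {B : Type} [TopologicalSpace B] [T2Space B] [ChartedSpace (EuclideanHalfSpace 4) B] {ι : Type} [Finite ι] {h : ι → Literature.Topology.FourManifolds.HandleAttachingMap 3 2 B} {X : Type} [TopologicalSpace X] [ChartedSpace (EuclideanHalfSpace 4) X] [IsManifold (𝓡∂ 4) ∞ X] (D : Literature.Topology.FourManifolds.HandleAttachingMap.MultiAttachmentData h (𝓡∂ 4) X) {ι' : Type} [Finite ι'] (f : ι' → ι) {bX : Literature.Topology.FourManifolds.BoundaryData (𝓡∂ 4) X (𝓡 3)} {W : Type} [TopologicalSpace W] [ChartedSpace (EuclideanHalfSpace 4) W] [IsManifold (𝓡∂ 4) ∞ W] {bW : Literature.Topology.FourManifolds.BoundaryData (𝓡∂ 4) W (𝓡 3)} [Nonempty bX.carrier] (G : Literature.Topology.FourManifolds.BoundaryGlueData bX bW) {a κ δ : ℝ}, 0 < a → Function.Injective f → (∀ j, Summit.SmoothPoincare4.SmoothPoincare4.Theorems.AcyclicBisectionExists.ModpBraidOrbits.CollarAdapted D (f j) G a) → 0 <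 κ → κ ≤ 1 / 2 → 0 < δ → δ ≤ 1 / 2 → (∀ (j : ι') (b : ↥(Literature.Topology.FourManifolds.beltPiece 3 2)), (0 ≤ Summit.SmoothPoincare4.SmoothPoincare4.Theorems.AcyclicBisectionExists.ModpBraidOrbits.levelFn D f G a κ δ (G.jM (D.jB (f j) b)) ↔ 0 ≤ Summit.SmoothPoincare4.SmoothPoincare4.Theorems.AcyclicBisectionExists.ModpBraidOrbits.modelH κ δ ((b : Metric.closedBall (0 : EuclideanSpace ℝ (Fin 4)) 1) : EuclideanSpace ℝ (Fin 4))) ∧ (Summit.SmoothPoincare4.SmoothPoincare4.Theorems.AcyclicBisectionExists.ModpBraidOrbits.levelFn D f G a κ δ (G.jM (D.jB (f j) b)) ≤ 0 ↔ Summit.SmoothPoincare4.SmoothPoincare4.Theorems.AcyclicBisectionExists.ModpBraidOrbits.modelH κ δ ((b : Metric.closedBall (0 : EuclideanSpace ℝ (Fin 4)) 1) : EuclideanSpace ℝ (Fin 4)) ≤ 0 ∨ ‖((b : Metric.closedBall (0 : EuclideanSpace ℝ (Fin 4)) 1) : EuclideanSpace ℝ (Fin 4))‖ = 1)) ∧ (∀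 y : X, (∀ (j : ι') (b : ↥(Literature.Topology.FourManifolds.beltPiece 3 2)), D.jB (f j) b ≠ y) → Summit.SmoothPoincare4.SmoothPoincare4.Theorems.AcyclicBisectionExists.ModpBraidOrbits.levelFn D f G a κ δ (G.jM y) = G.CM.collarHeightFn y) ∧ (∀ c : W, Summit.SmoothPoincare4.SmoothPoincare4.Theorems.AcyclicBisectionExists.ModpBraidOrbits.levelFn D f G a κ δ (G.jN c) ≤ 0) ∧ (∀ c : W, (𝓡∂ 4).IsInteriorPoint c → Summit.SmoothPoincare4.SmoothPoincare4.Theorems.AcyclicBisectionExists.ModpBraidOrbits.levelFn D f G a κ δ (G.jN c) < 0) := by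
  intro B _ _ _ ι _ h X _ _ _ D ι' _ f bX W _ _ _ bW _ G a κ δ ha hf hCM hκ hκ2 hδ hδ2
  exact ⟨fun j b => ⟨levelFn_jM_jB_nonneg_iff D f G ha hf hCM hκ hκ2 hδ hδ2 j b,
      levelFn_jM_jB_nonpos_iff D f G ha hf hCM hκ hκ2 hδ hδ2 j b⟩,
    fun y hy => levelFn_jM_of_forall_ne D f G ha hCM hκ hκ2 hy,
    fun c => levelFn_jN_nonpos D f G ha hf hCM hκ hκ2 hδ hδ2 c,
    fun c hc => levelFn_jN_neg D f G ha hf hCM hκ hκ2 hδ hδ2 hc⟩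

end Signs

end Summit.SmoothPoincare4.SmoothPoincare4.Theorems.AcyclicBisectionExists.ModpBraidOrbits

end
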